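import Literature.IUT.LogThetaLattice.GlobalLGPFrobenioidsModFrakPerfFactorial
import Literature.IUT.LogThetaLattice.GlobalLGPFrobenioidsRealification
import Literature.AlgebraicGeometry.Frobenioids.DirectSumPrimes
import Literature.AlgebraicGeometry.Frobenioids.Thm36SubProofs2
import HarnessLib

/-!
# [IUTchIII] Prop. 3.7 (ii) / [FrdI] Thm. 6.4 (i): `ℝ` SUPPORTS the realified divisor monoid `⊕'_v ℝ_{≥0}` of
# `(†𝓕⊛ℝ_𝔪𝔬𝔡)_α`, and the effective realification map `Φ(∗) → Φ^ℝ(∗)` (abc-iut cell, layer L6; sub-row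
# «J1-rlf-bridge», piece (3a); written by abc-iut-w4-d015)

S. Mochizuki, *The geometry of Frobenioids I*, Def. 2.4 (ii) p. 48 ("`Λ` supports `M` if … (c) `Λ = ℝ`, `M` is
perfect and perf-factorial, and every `M_𝔭` is `ℝ`-monoprime") [cite: MochizukiFrdI2008, Def. 2.4(ii) p.48], Thm. 6.4
(i) p. 115 ("`(Φ^rlf)^gp(L) = ArithDiv_ℝ(L)`", the realified arithmetic divisors `⊕_v ℝ`) [cite: MochizukiFrdI2008,
Thm. 6.4 (i) p.115]; S. Mochizuki, *Inter-universal Teichmüller theory III*, Prop. 3.7 (ii) p. 110 l. 48–49 ("Write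
`(†𝓕⊛ℝ_𝔪𝔬𝔡)_α` for the realification") [claim: Mochizuki2012, status: disputed].

WHY. Piece (3) of the sub-row identifies THE canonical realification `Φ(∗)^rlf` ([FrdI] Def. 2.4 (i), layer L1's
`IsPerfFactorial.Rlf` of the INTEGRAL divisor monoid `Φ(∗) = EffDiv (Places F) (Gamma F) (nonneg F)`, perf-factorial
by `Prop37.isPerfFactorial_effDiv`) with the REAL divisor monoid `Φ^ℝ(∗) := EffDiv (ModelPlaces F) (fun _ ↦ ℝ)
nonnegModel` of abc-iut-L6-t6 / abc-iut-L6-d1 (the divisor monoid of `(†𝓕⊛ℝ_𝔪𝔬𝔡)_α = Prop37.FrakRlfCat F`) via the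
UNIVERSAL PROPERTY of `M^pf → M^rlf` among monoids supported by `ℝ` (abc-iut-L2-d2
`RlfUniversal.existsUnique_lift`). This file supplies the two inputs of that argument that concern `Φ^ℝ(∗)` alone:

* `Prop37.realifyEff : effDiv (Places F) (Gamma F) (nonneg F) →+ effDiv (ModelPlaces F) (fun _ ↦ ℝ) nonnegModel`
  — abc-iut-w4-d005's `realifyObjHom` restricted to effective families (`realifyObj_mem_effDiv_iff`), with its
  multiplicative form `realifyEffMul`; injective;
* `Prop37.effDivRealMulEquivDirectSum : EffDiv (ModelPlaces F) (fun _ ↦ ℝ) nonnegModel ≃* directSum (fun _ ↦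
  Multiplicative ℝ_{≥0})` — `Φ^ℝ(∗)` IS the direct sum `⊕_{v ∈ ModelPlaces F} ℝ_{≥0}` of layer L1 (`DirectSumMonoids`);
* `DirectSum.isPerfect`, `DirectSum.supports_R_of_isRMonoprime` — a direct sum of `ℝ`-monoprime monoids is supported
  by `ℝ` (perfect; perf-factorial by L1-d2 `DirectSum.isPerfFactorial`; `(⊕ M)_𝔭 ≅ M_{idx 𝔭}` `ℝ`-monoprime by
  `DirectSum.submonoidEquiv`); `Supports.of_mulEquiv_R` (transport);
* **`Prop37.supports_R_effDivReal : Supports (EffDiv (ModelPlaces F) (fun _ ↦ ℝ) nonnegModel) .R`**.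

Nothing here asserts a disputed claim or takes a side on [IUTchIII] Cor. 3.12; typed ≠ discharged; instantiated ≠
endorsed.
-/

noncomputable section

open scoped NNReal

/-! ### Direct sums of `ℝ`-monoprime monoids are supported by `ℝ`; transport of `Supports · .R` -/

namespace Literature.AlgebraicGeometry.Frobenioids

open Function Literature.AnabelianGeometry.EtaleTheta

universe u v

/-- **`Supports · .R` transports along isomorphisms of monoids** ([FrdI] Def. 2.4 (ii)(c): perfect, perf-factorial,
every `M_𝔭` `ℝ`-monoprime — each clause iso-invariant). [cite: MochizukiFrdI2008, Def. 2.4(ii) p.48] -/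
theorem Supports.of_mulEquiv_R {N N' : Type u} [CommMonoid N] [CommMonoid N'] (e : N ≃* N')
    (h : Supports N MonoidType.R) : Supports N' MonoidType.R := by
  refine ⟨h.1.of_mulEquiv e, h.2.1.of_mulEquiv e, fun 𝔭' => ?_⟩
  exact (h.2.2 (Primes.congr e.symm 𝔭')).of_mulEquiv
    (Primes.submonoidCongr e (Primes.congr e.symm 𝔭') 𝔭' (Primes.congr_apply_congr_symm e 𝔭'))

namespace DirectSum

variable {ι : Type u} {M : ι → Type v} [∀ i, CommMonoid (M i)]

/-- **A direct sum of PERFECT monoids is perfect**: `n`-th powers are bijective componentwise, and the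
componentwise `n`-th root of a finitely supported family is finitely supported (`a^n = 1 ⇒ a = 1` in a perfect
monoid). [cite: MochizukiFrdI2008, §0 p.11] -/
theorem isPerfect (hM : ∀ i, IsPerfect (M i)) : IsPerfect (directSum M) := by
  refine ⟨fun n hn => ⟨fun f g hfg => ?_, fun g => ?_⟩⟩
  · refine Subtype.ext (funext fun i => (hM i).bijective_pow n hn |>.1 ?_)
    have := congrArg (fun h : directSum M => (h : ∀ i, M i) i) hfg
    simpa [coe_pow] using this
  · choose r hr using fun i => ((hM i).bijective_pow n hn).2 ((g : ∀ i, M i) i)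
    have hsupp : dsupp (fun i => r i) ⊆ dsupp (g : ∀ i, M i) := by
      intro i hi
      rw [dsupp, Set.mem_setOf_eq] at hi ⊢
      intro hgi
      apply hi
      apply ((hM i).bijective_pow n hn).1
      show r i ^ n = (1 : M i) ^ n
      rw [one_pow]
      exact (hr i).trans hgi
    refine ⟨⟨fun i => r i, (finite_dsupp g).subset hsupp⟩, Subtype.ext (funext fun i => ?_)⟩
    show ((⟨fun i => r i, _⟩ : directSum M) ^ n : directSum M).1 i = (g : ∀ i, M i) i
    rw [coe_pow, Pi.pow_apply]
    exact hr i

/-- `IsPerfect` transports along an isomorphism of monoids living in different universes (the tree's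
`IsPerfect.of_mulEquiv` is the same-universe case). [cite: MochizukiFrdI2008, §0 p.11] -/
theorem _root_.Literature.AlgebraicGeometry.Frobenioids.IsPerfect.of_mulEquiv_univ {N : Type u} {N' : Type v}
    [CommMonoid N] [CommMonoid N'] (e : N ≃* N') (h : IsPerfect N) : IsPerfect N' := by
  refine ⟨fun n hn => ?_⟩
  have key : (fun a : N' => a ^ n) = e ∘ (fun a : N => a ^ n) ∘ e.symm := by
    funext a
    simp [Function.comp, map_pow]
  rw [key]
  exact e.bijective.comp ((h.bijective_pow n hn).comp e.symm.bijective)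

variable [DecidableEq ι]

/-- **A direct sum of `ℝ`-monoprime monoids is supported by `ℝ`** ([FrdI] Def. 2.4 (ii)(c)): perfect (each
`M_i ≅ ℝ_{≥0}` is perfect), perf-factorial (`DirectSum.isPerfFactorial`), and every `(⊕ M)_𝔭 ≅ M_{idx 𝔭}` is
`ℝ`-monoprime (`DirectSum.submonoidEquiv`). [cite: MochizukiFrdI2008, Def. 2.4(ii) p.48] -/
theorem supports_R_of_isRMonoprime {ι : Type u} {M : ι → Type u} [∀ i, CommMonoid (M i)] [DecidableEq ι]
    (hM : ∀ i, IsRMonoprime (M i)) : Supports (directSum M) MonoidType.R := by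
  have hmono : ∀ i, IsMonoprime (M i) := fun i => IsMonoprime.ofR (hM i)
  have hperf : ∀ i, IsPerfect (M i) := fun i => by
    obtain ⟨e⟩ := (hM i).nonempty_mulEquiv
    exact isPerfect_multiplicative_nnreal.of_mulEquiv_univ e.symm
  refine ⟨isPerfect hperf, isPerfFactorial hmono, fun P => ?_⟩
  exact (hM (idx hmono P)).of_mulEquiv (submonoidEquiv hmono P (idx hmono P) (primeOf_idx hmono P)).symm

end DirectSum

/-- `ℝ_{≥0}` (multiplicatively) is `ℝ`-monoprime. [cite: MochizukiFrdI2008, §0 p.10] -/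
theorem isRMonoprime_multiplicative_nnreal : IsRMonoprime (Multiplicative ℝ≥0) := ⟨⟨MulEquiv.refl _⟩⟩

end Literature.AlgebraicGeometry.Frobenioids

namespace Literature.IUT.LogThetaLattice

namespace Prop37

open NumberField GlobalFrobenioidModels Literature.AlgebraicGeometry.Frobenioids

section Realify

variable (F : Type) [Field F] [NumberField F]

/-! ### The effective realification map `Φ(∗) → Φ^ℝ(∗)` -/

/-- **The realification on effective divisors** `Φ(∗) → Φ^ℝ(∗)`: abc-iut-w4-d005's `realifyObjHom` (integral
families ↦ real families: `ℤ ↪ ℝ` at finite places, identity at archimedean ones) restricted to the effective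
families (`realifyObj_mem_effDiv_iff`). [cite: MochizukiFrdI2008, Prop. 5.3 p.103] -/
def realifyEff : effDiv (Places F) (Gamma F) (nonneg F) →+ effDiv (ModelPlaces F) (fun _ => ℝ) nonnegModel where
  toFun D := ⟨realifyObj F D, (realifyObj_mem_effDiv_iff F _).mpr D.2⟩
  map_zero' := Subtype.ext (by
    show realifyObj F (0 : FrakObj (Places F) (Gamma F)) = 0
    rw [← realifyObjHom_apply, map_zero])
  map_add' D₁ D₂ := Subtype.ext (by
    show realifyObj F ((D₁ : FrakObj (Places F) (Gamma F)) + D₂) = realifyObj F D₁ + realifyObj F D₂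
    rw [← realifyObjHom_apply, map_add, realifyObjHom_apply, realifyObjHom_apply])

/-- `realifyEff` on underlying families is `realifyObj`. [cite: MochizukiFrdI2008, Prop. 5.3 p.103] -/
@[simp] theorem coe_realifyEff (D : effDiv (Places F) (Gamma F) (nonneg F)) :
    (realifyEff F D : FrakObj (ModelPlaces F) (fun _ => ℝ)) = realifyObj F D := rfl

/-- `realifyEff` is injective (`ℤ ↪ ℝ`; abc-iut-w4-d005 `realifyObj_injective`). [cite: MochizukiFrdI2008, Prop. 5.3 p.103] -/
theorem realifyEff_injective : Function.Injective (realifyEff F) := fun _ _ h =>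
  Subtype.ext (realifyObj_injective F (congrArg Subtype.val h))

/-- The effective realification in the MULTIPLICATIVE rendering `Φ(∗) → Φ^ℝ(∗)` of layer L1.
[cite: MochizukiFrdI2008, Prop. 5.3 p.103] -/
def realifyEffMul : EffDiv (Places F) (Gamma F) (nonneg F) →* EffDiv (ModelPlaces F) (fun _ => ℝ) nonnegModel :=
  AddMonoidHom.toMultiplicative (realifyEff F)

/-- `realifyEffMul` unfolded. [cite: MochizukiFrdI2008, Prop. 5.3 p.103] -/
@[simp] theorem realifyEffMul_apply (x : EffDiv (Places F) (Gamma F) (nonneg F)) :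
    realifyEffMul F x = Multiplicative.ofAdd (realifyEff F x.toAdd) := rfl

/-- `realifyEffMul` is injective. [cite: MochizukiFrdI2008, Prop. 5.3 p.103] -/
theorem realifyEffMul_injective : Function.Injective (realifyEffMul F) := fun _ _ h =>
  Multiplicative.toAdd.injective (realifyEff_injective F (Multiplicative.ofAdd.injective h))

end Realify

/-! ### `Φ^ℝ(∗) = ⊕_{v ∈ ModelPlaces F} ℝ_{≥0}` and `ℝ` supports it -/

section Real

variable (F : Type) [Field F]

/-- An effective real family has nonnegative classes. [cite: MochizukiFrdI2008, Thm. 6.4 (i) p.115] -/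
theorem cls_nonneg_real (D : effDiv (ModelPlaces F) (fun _ => ℝ) nonnegModel) (p : ModelPlaces F) :
    (0 : ℝ) ≤ (D : FrakObj (ModelPlaces F) (fun _ => ℝ)).cls p :=
  D.2 p

/-- The coordinates of an effective real family as a finitely supported family in `∏_v ℝ_{≥0}`.
[cite: MochizukiFrdI2008, Thm. 6.4 (i) p.115] -/
def toDirectSumFun (D : effDiv (ModelPlaces F) (fun _ => ℝ) nonnegModel) : ModelPlaces F → Multiplicative ℝ≥0 :=
  fun p => Multiplicative.ofAdd ⟨(D : FrakObj (ModelPlaces F) (fun _ => ℝ)).cls p, cls_nonneg_real F D p⟩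

/-- `toDirectSumFun D` read back in `ℝ`. [cite: MochizukiFrdI2008, Thm. 6.4 (i) p.115] -/
@[simp] theorem coe_toAdd_toDirectSumFun (D : effDiv (ModelPlaces F) (fun _ => ℝ) nonnegModel) (p : ModelPlaces F) :
    ((Multiplicative.toAdd (toDirectSumFun F D p) : ℝ≥0) : ℝ) = (D : FrakObj (ModelPlaces F) (fun _ => ℝ)).cls p :=
  rfl

/-- The support of `toDirectSumFun D` is the support of `D`. [cite: MochizukiFrdI2008, Thm. 6.4 (i) p.115] -/
theorem dsupp_toDirectSumFun (D : effDiv (ModelPlaces F) (fun _ => ℝ) nonnegModel) :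
    dsupp (toDirectSumFun F D) = {p | (D : FrakObj (ModelPlaces F) (fun _ => ℝ)).cls p ≠ 0} := by
  ext p
  simp only [dsupp, Set.mem_setOf_eq, toDirectSumFun, ne_eq]
  rw [← ofAdd_zero, Multiplicative.ofAdd.injective.eq_iff, ← NNReal.coe_inj]
  rfl

/-- The real family with coordinates a finitely supported `f ∈ ⊕_v ℝ_{≥0}`. [cite: MochizukiFrdI2008, Thm. 6.4 (i) p.115] -/
def ofDirectSum (f : directSum (fun _ : ModelPlaces F => Multiplicative ℝ≥0)) :
    effDiv (ModelPlaces F) (fun _ => ℝ) nonnegModel :=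
  ⟨⟨fun p => ((Multiplicative.toAdd ((f.1 : ModelPlaces F → Multiplicative ℝ≥0) p) : ℝ≥0) : ℝ), by
      refine (DirectSum.finite_dsupp f).subset fun p hp => ?_
      rw [dsupp, Set.mem_setOf_eq]
      intro h1
      exact hp (by rw [h1]; rfl)⟩,
    fun p => AddSubmonoid.mem_nonneg.mpr
      (show (0 : ℝ) ≤ ((Multiplicative.toAdd ((f.1 : ModelPlaces F → Multiplicative ℝ≥0) p) : ℝ≥0) : ℝ) from
        ((Multiplicative.toAdd ((f.1 : ModelPlaces F → Multiplicative ℝ≥0) p)) : ℝ≥0).2)⟩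

/-- Classes of `ofDirectSum f`. [cite: MochizukiFrdI2008, Thm. 6.4 (i) p.115] -/
@[simp] theorem ofDirectSum_cls (f : directSum (fun _ : ModelPlaces F => Multiplicative ℝ≥0)) (p : ModelPlaces F) :
    (ofDirectSum F f : FrakObj (ModelPlaces F) (fun _ => ℝ)).cls p =
      ((Multiplicative.toAdd ((f.1 : ModelPlaces F → Multiplicative ℝ≥0) p) : ℝ≥0) : ℝ) := rfl

/-- **`Φ^ℝ(∗)` IS `⊕_{v ∈ ModelPlaces F} ℝ_{≥0}`** ([FrdI] Thm. 6.4 (i) "`(Φ^rlf)^gp(L) = ⊕_v ℝ`": the effective real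
families of abc-iut-L6-t6/L6-d1's real datum, multiplicatively, are layer L1's direct sum of copies of `ℝ_{≥0}`),
coordinate by coordinate. [cite: MochizukiFrdI2008, Thm. 6.4 (i) p.115] -/
def effDivRealMulEquivDirectSum :
    EffDiv (ModelPlaces F) (fun _ => ℝ) nonnegModel ≃* directSum (fun _ : ModelPlaces F => Multiplicative ℝ≥0) where
  toFun x := ⟨toDirectSumFun F x.toAdd, by
    show (dsupp (toDirectSumFun F x.toAdd)).Finite
    rw [dsupp_toDirectSumFun]
    exact (x.toAdd : FrakObj (ModelPlaces F) (fun _ => ℝ)).finite⟩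
  invFun f := Multiplicative.ofAdd (ofDirectSum F f)
  left_inv x := by
    refine Multiplicative.toAdd.injective (Subtype.ext (FrakObj.ext_cls (funext fun _ => ?_)))
    rfl
  right_inv f := Subtype.ext (funext fun _ => by
    apply Multiplicative.toAdd.injective
    exact NNReal.eq rfl)
  map_mul' x y := Subtype.ext (funext fun p => by
    apply Multiplicative.toAdd.injective
    apply NNReal.eq
    show ((x * y).toAdd : FrakObj (ModelPlaces F) (fun _ => ℝ)).cls p =
      (x.toAdd : FrakObj (ModelPlaces F) (fun _ => ℝ)).cls p + (y.toAdd : FrakObj (ModelPlaces F) (fun _ => ℝ)).cls p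
    rw [toAdd_mul, AddSubmonoid.coe_add, FrakObj.cls_add])

/-- Coordinates of `effDivRealMulEquivDirectSum`. [cite: MochizukiFrdI2008, Thm. 6.4 (i) p.115] -/
@[simp] theorem coe_effDivRealMulEquivDirectSum_apply (x : EffDiv (ModelPlaces F) (fun _ => ℝ) nonnegModel)
    (p : ModelPlaces F) :
    ((Multiplicative.toAdd ((effDivRealMulEquivDirectSum F x).1 p) : ℝ≥0) : ℝ) =
      (x.toAdd : FrakObj (ModelPlaces F) (fun _ => ℝ)).cls p := rfl

/-- **`ℝ` supports `Φ^ℝ(∗)`** ([FrdI] Def. 2.4 (ii)(c)): the realified divisor monoid `⊕'_v ℝ_{≥0}` of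
`(†𝓕⊛ℝ_𝔪𝔬𝔡)_α` is perfect, perf-factorial, with `ℝ`-monoprime prime components — the standing hypothesis of the
universal property of `M^pf → M^rlf` (abc-iut-L2-d2 `RlfUniversal.existsUnique_lift`) for the target `Φ^ℝ(∗)`.
[cite: MochizukiFrdI2008, Def. 2.4(ii) p.48] -/
theorem supports_R_effDivReal : Supports (EffDiv (ModelPlaces F) (fun _ => ℝ) nonnegModel) MonoidType.R := by
  classical
  exact Supports.of_mulEquiv_R (effDivRealMulEquivDirectSum F).symm
    (DirectSum.supports_R_of_isRMonoprime fun _ => isRMonoprime_multiplicative_nnreal)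

/-- In particular `Φ^ℝ(∗)` is perf-factorial. [cite: MochizukiFrdI2008, Def. 2.4(i) p.47] -/
theorem isPerfFactorial_effDivReal : IsPerfFactorial (EffDiv (ModelPlaces F) (fun _ => ℝ) nonnegModel) :=
  (supports_R_effDivReal F).2.1

/-- … and perfect. [cite: MochizukiFrdI2008, §0 p.11] -/
theorem isPerfect_effDivReal : IsPerfect (EffDiv (ModelPlaces F) (fun _ => ℝ) nonnegModel) :=
  (supports_R_effDivReal F).1

end Real

end Prop37

end Literature.IUT.LogThetaLattice

end
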